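import Summits.KontsevichZagierPeriods.KontsevichZagierPeriods.Theorems.GpcLegendreLemniscatic.Negative.Canonical

/-!
# `GpcLegendreLemniscatic` (stmt-KontsevichZagierPeriods-0280) — negative knowledge, part 2: load-bearing hypotheses and necessary moves

Support file for the crux `Grothendieck.GpcLegendreLemniscatic` (cdisprove seat, gen 1), on top of
part 1 (`Canonical`). Contents: (§2) each of the four pinning hypotheses of the crux is
LOAD-BEARING — the crux with that hypothesis deleted is false (`gpcLegendre_false_without_domainL /
_integrandL / _domainR / _integrandR`, witnesses `[∅,0]`, `[(0,1)²,0]`, `[∅,0]`, `[ℝ,0]`, separated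
by `KZ.eval` through the proved soundness); (§3) the dimension projection `dimProj d : FormalRep →+
FormalRep` and the invariant `eval ∘ dimProj d` of the SAME-DIMENSION moves (1a), (1b), (2)
(`closure_sameDim_le_ker`), whence `legendre_not_mem_closure_without_newtonLeibniz`: every derivation
of the crux uses a rule-(3) (Newton–Leibniz) move. [cite: KontsevichZagier2001, §1.2]
-/

noncomputable section

open MeasureTheory Set
open Literature.NumberTheory.Transcendental
open Literature.NumberTheory.Transcendental.KZ
open Literature.ModelTheory.ExponentialFields (IsSemialgebraic)
open MvPolynomial (aeval X C)
open Summit.KontsevichZagierPeriods.KontsevichZagierPeriods.Theses.Grothendieck (GpcLegendreLemniscatic)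

namespace Summit.KontsevichZagierPeriods.Grothendieck.GpcLegendreLemniscaticNegative

/-! ## §2 Load-bearing hypotheses: each of the four pinning hypotheses is necessary

The crux has four hypotheses: `hD : r.domain = (0,1)²`, `hF : r.integrand = crux integrand on
the domain`, `hD' : r'.domain = ℝ`, `hF' : r'.integrand = 1/(2(1+x²)) on the domain`. Dropping
any one of them gives a FALSE statement (witness: an empty-domain or zero-integrand
representation, separated by `KZ.eval` through the proved soundness
`KZ.Equivalent.value_eq_holds`). So all four are load-bearing — as expected, since each pins a
value. -/

/-- The empty representation in dimension `n` (value `0`). [folklore] -/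
def emptyRep (n : ℕ) : IntegralRep n where
  domain := ∅
  integrand := fun _ => 0
  isSemialgebraic_domain := Literature.ModelTheory.ExponentialFields.isSemialgebraic_empty
  isSemialgebraicFunOn_integrand :=
    (isSemialgebraicFunOn_ratCast (m := n)
      (Literature.ModelTheory.ExponentialFields.isSemialgebraic_univ) 0).mono (empty_subset _)
      Literature.ModelTheory.ExponentialFields.isSemialgebraic_empty |>.congr fun x _ => by simp
  integrableOn := integrableOn_empty

/-- The empty representation has value `0`. [folklore] -/
@[simp] theorem emptyRep_value (n : ℕ) : (emptyRep n).value = 0 := by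
  simp [IntegralRep.value, emptyRep]

/-- The zero representation on a semialgebraic domain (value `0`). [folklore] -/
def zeroRep {n : ℕ} (σ : Set (Fin n → ℝ)) (hσ : IsSemialgebraic ℚ σ) : IntegralRep n where
  domain := σ
  integrand := fun _ => 0
  isSemialgebraic_domain := hσ
  isSemialgebraicFunOn_integrand := (isSemialgebraicFunOn_ratCast hσ 0).congr fun x _ => by simp
  integrableOn := integrableOn_zero

/-- The zero representation has value `0`. [folklore] -/
@[simp] theorem zeroRep_value {n : ℕ} (σ : Set (Fin n → ℝ)) (hσ : IsSemialgebraic ℚ σ) :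
    (zeroRep σ hσ).value = 0 := by
  simp [IntegralRep.value, zeroRep]

/-- `(0,1)²` is `ℚ`-semialgebraic. [folklore] -/
theorem isSemialgebraic_unitSq : IsSemialgebraic ℚ unitSq :=
  legendreRep_domain ▸ legendreRep.isSemialgebraic_domain

/-- The crux with `hD : r.domain = (0,1)²` dropped (a route-item VARIANT, not a cited fact). -/
def WithoutDomainL : Prop :=
  ∀ (r : IntegralRep 2) (r' : IntegralRep 1), EqOn r.integrand cruxIntegrand r.domain →
    r'.domain = univ → EqOn r'.integrand (fun x => 1 / (2 * (1 + x 0 ^ 2))) r'.domain → Equivalent r r'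

/-- The crux with `hF : r.integrand = …` dropped (a route-item VARIANT, not a cited fact). -/
def WithoutIntegrandL : Prop :=
  ∀ (r : IntegralRep 2) (r' : IntegralRep 1), r.domain = unitSq →
    r'.domain = univ → EqOn r'.integrand (fun x => 1 / (2 * (1 + x 0 ^ 2))) r'.domain → Equivalent r r'

/-- The crux with `hD' : r'.domain = ℝ` dropped (a route-item VARIANT, not a cited fact). -/
def WithoutDomainR : Prop :=
  ∀ (r : IntegralRep 2) (r' : IntegralRep 1), r.domain = unitSq → EqOn r.integrand cruxIntegrand r.domain →
    EqOn r'.integrand (fun x => 1 / (2 * (1 + x 0 ^ 2))) r'.domain → Equivalent r r'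

/-- The crux with `hF' : r'.integrand = 1/(2(1+x²))` dropped (a route-item VARIANT, not a cited fact). -/
def WithoutIntegrandR : Prop :=
  ∀ (r : IntegralRep 2) (r' : IntegralRep 1), r.domain = unitSq → EqOn r.integrand cruxIntegrand r.domain →
    r'.domain = univ → Equivalent r r'

/-- Sanity: the crux is the conjunction-shape of the four hypotheses (definitional unfolding). [folklore] -/
theorem gpcLegendre_iff_pinned : GpcLegendreLemniscatic ↔
    ∀ (r : IntegralRep 2) (r' : IntegralRep 1), r.domain = unitSq → EqOn r.integrand cruxIntegrand r.domain →
      r'.domain = univ → EqOn r'.integrand (fun x => 1 / (2 * (1 + x 0 ^ 2))) r'.domain → Equivalent r r' :=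
  Iff.rfl

/-- `π/2 ≠ 0`. [folklore] -/
theorem pi_div_two_ne_zero : Real.pi / 2 ≠ 0 := by positivity

/-- **`hD` is load-bearing**: witness `r = [∅, 0]` (value `0`) against `r₀'` (value `π/2`). [folklore] -/
theorem gpcLegendre_false_without_domainL : ¬ WithoutDomainL := by
  intro h
  have hE := h (emptyRep 2) arctanRep (fun x hx => hx.elim) rfl (fun x _ => rfl)
  have hv := Equivalent.value_eq_holds hE
  rw [emptyRep_value, arctanRep_value] at hv
  exact pi_div_two_ne_zero hv.symm

/-- **`hF` is load-bearing**: witness `r = [(0,1)², 0]` (value `0`) against `r₀'`. [folklore] -/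
theorem gpcLegendre_false_without_integrandL : ¬ WithoutIntegrandL := by
  intro h
  have hE := h (zeroRep unitSq isSemialgebraic_unitSq) arctanRep rfl rfl (fun x _ => rfl)
  have hv := Equivalent.value_eq_holds hE
  rw [zeroRep_value, arctanRep_value] at hv
  exact pi_div_two_ne_zero hv.symm

/-- **`hD'` is load-bearing**: witness `r' = [∅, 0]` (value `0`) against `r₀` (value `π/2`). [folklore] -/
theorem gpcLegendre_false_without_domainR : ¬ WithoutDomainR := by
  intro h
  have hE := h legendreRep (emptyRep 1) legendreRep_domain
    (fun x hx => (legendreRep_integrand_apply x).trans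
      (cruxIntegrand_eq (by rw [legendreRep_domain] at hx; exact hx)).symm)
    (fun x hx => hx.elim)
  have hv := Equivalent.value_eq_holds hE
  rw [emptyRep_value, legendreRep_value] at hv
  exact pi_div_two_ne_zero hv

/-- **`hF'` is load-bearing**: witness `r' = [ℝ, 0]` (value `0`) against `r₀`. [folklore] -/
theorem gpcLegendre_false_without_integrandR : ¬ WithoutIntegrandR := by
  intro h
  have hE := h legendreRep (zeroRep univ Literature.ModelTheory.ExponentialFields.isSemialgebraic_univ)
    legendreRep_domain
    (fun x hx => (legendreRep_integrand_apply x).trans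
      (cruxIntegrand_eq (by rw [legendreRep_domain] at hx; exact hx)).symm) rfl
  have hv := Equivalent.value_eq_holds hE
  rw [zeroRep_value, legendreRep_value] at hv
  exact pi_div_two_ne_zero hv

/-! ## §3 Which moves are necessary: Newton–Leibniz (proved) and additivity (o-minimal χ, informal)

`dimProj d` keeps the generators of dimension `d`. The three SAME-DIMENSION moves (1a), (1b), (2)
are homogeneous, so `eval ∘ dimProj d` kills the subgroup they generate, for every `d`; the
Newton–Leibniz move (3) is the only move mixing dimensions. Since `[r₀] − [r₀']` has
`eval (dimProj 2 ·) = value r₀ = π/2 ≠ 0`, **every derivation of the crux uses rule (3)** (as the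
planned chain does: two NL moves, the `F′`-cancellation and `B(1, ¼) = 4`).

ADDITIVITY IS NECESSARY TOO (not formalised — no o-minimal Euler characteristic in Mathlib): the
o-minimal Euler characteristic `χ(domain)` is invariant under rule (2) (a semialgebraic bijection
`σ → Φ(σ)`, van den Dries 1998 Ch. 4 (2.4)) and under rule (3) (a band with closed bounded fibres
over `τ` has `χ = χ(τ)`), but `χ((0,1)²) = 1 ≠ −1 = χ(ℝ)`; so `[r₀] − [r₀'] ∉ closure(rules 2, 3)`
and some additivity move (1a)/(1b) must occur (the chain uses (1b) to split off the exact term and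
(1a) for null-set adjustments and `ℝ = (−∞,0] ∪ [0,∞)`). The cheap substitutes fail: `KZ.coeffSum`
vanishes on `[r₀] − [r₀']`, and connectedness / compactness of the domain are not rule-(2)
invariants (`(0,1) ∪ [2,3) → (0,2)`, `t ↦ t, t − 1` is an admissible change of variables). -/

/-- Projection of a formal combination onto its dimension-`d` part. [folklore] -/
def dimProj (d : ℕ) : FormalRep →+ FormalRep :=
  FreeAbelianGroup.lift fun p => if p.1 = d then FreeAbelianGroup.of p else 0

/-- `dimProj` on a generator. [folklore] -/
theorem dimProj_of {n : ℕ} (d : ℕ) (r : IntegralRep n) :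
    dimProj d (of r) = if n = d then of r else 0 := by
  simp only [dimProj, of, FreeAbelianGroup.lift_apply_of]

/-- A homogeneous three-term combination projects to itself or to `0`. [folklore] -/
theorem dimProj_sub_sub {n : ℕ} (d : ℕ) (r r₁ r₂ : IntegralRep n) :
    dimProj d (of r - of r₁ - of r₂) = if n = d then of r - of r₁ - of r₂ else 0 := by
  simp only [map_sub, dimProj_of]
  split_ifs <;> simp

/-- A homogeneous two-term combination projects to itself or to `0`. [folklore] -/
theorem dimProj_sub {n : ℕ} (d : ℕ) (r r' : IntegralRep n) :
    dimProj d (of r - of r') = if n = d then of r - of r' else 0 := by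
  simp only [map_sub, dimProj_of]
  split_ifs <;> simp

/-- **Rules (1a), (1b), (2) preserve `eval ∘ dimProj d`** for every dimension `d`. [folklore] -/
theorem closure_sameDim_le_ker (d : ℕ) :
    AddSubgroup.closure (domainAddRel ∪ integrandAddRel ∪ changeOfVariablesRel) ≤
      (eval.comp (dimProj d)).ker := by
  refine (AddSubgroup.closure_le _).mpr ?_
  rintro c ((hc | hc) | hc) <;> simp only [SetLike.mem_coe, AddMonoidHom.mem_ker, AddMonoidHom.coe_comp,
    Function.comp_apply]
  · obtain ⟨n, r, r₁, r₂, h1, h2, h3, h4, rfl⟩ := hc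
    rw [dimProj_sub_sub]
    split_ifs
    · exact eval_eq_zero_of_mem_domainAddRel_holds ⟨n, r, r₁, r₂, h1, h2, h3, h4, rfl⟩
    · simp
  · obtain ⟨n, r, r₁, r₂, h1, h2, h3, rfl⟩ := hc
    rw [dimProj_sub_sub]
    split_ifs
    · exact eval_eq_zero_of_mem_integrandAddRel_holds ⟨n, r, r₁, r₂, h1, h2, h3, rfl⟩
    · simp
  · obtain ⟨n, r, r', Φ, Φ', h1, h2, h3, h4, h5, rfl⟩ := hc
    rw [dimProj_sub]
    split_ifs
    · exact eval_eq_zero_of_mem_changeOfVariablesRel_holds ⟨n, r, r', Φ, Φ', h1, h2, h3, h4, h5, rfl⟩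
    · simp

/-- `eval (dimProj 2 ([r₀] − [r₀'])) = π/2`. [folklore] -/
theorem eval_dimProj_two_legendre :
    eval (dimProj 2 (of legendreRep - of arctanRep)) = Real.pi / 2 := by
  rw [map_sub, dimProj_of, dimProj_of]
  simp [legendreRep_value]

/-- **Newton–Leibniz is necessary**: `[r₀] − [r₀']` is NOT in the subgroup generated by the
additivity and change-of-variables moves alone (rules (1a), (1b), (2)); every derivation of the crux
contains a rule-(3) move. [folklore] -/
theorem legendre_not_mem_closure_without_newtonLeibniz :
    of legendreRep - of arctanRep ∉
      AddSubgroup.closure (domainAddRel ∪ integrandAddRel ∪ changeOfVariablesRel) := by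
  intro h
  have h0 := closure_sameDim_le_ker 2 h
  rw [AddMonoidHom.mem_ker, AddMonoidHom.coe_comp, Function.comp_apply, eval_dimProj_two_legendre] at h0
  exact pi_div_two_ne_zero h0

/-- The same for ANY admissible left representation of the crux against ANY one-dimensional
`r'` whatsoever (the hypotheses on `r'` are not even needed: MUTATION finding). [folklore] -/
theorem not_mem_closure_without_newtonLeibniz (r : IntegralRep 2) (r' : IntegralRep 1)
    (hd : r.domain = unitSq) (hf : EqOn r.integrand cruxIntegrand r.domain) :
    of r - of r' ∉ AddSubgroup.closure (domainAddRel ∪ integrandAddRel ∪ changeOfVariablesRel) := by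
  intro h
  have h0 := closure_sameDim_le_ker 2 h
  rw [AddMonoidHom.mem_ker, AddMonoidHom.coe_comp, Function.comp_apply, map_sub, dimProj_of,
    dimProj_of] at h0
  simp only [↓reduceIte, OfNat.one_ne_ofNat, eval_of, sub_zero] at h0
  have h1 : r.value = legendreRep.value := by
    refine Equivalent.value_eq_holds (equivalent_of_eqOn r legendreRep (legendreRep_domain.trans hd.symm) ?_)
    intro x hx
    have hx' : x ∈ unitSq := by rw [hd] at hx; exact hx
    rw [legendreRep_integrand_apply, ← cruxIntegrand_eq hx']
    exact hf hx
  rw [h1, legendreRep_value] at h0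
  exact pi_div_two_ne_zero h0


end Summit.KontsevichZagierPeriods.Grothendieck.GpcLegendreLemniscaticNegative
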